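import Summits.HodgeConjecture.HodgeConjecture.Theorems.Ring2HypothesesWeilComponentsSplit
import Summits.HodgeConjecture.HodgeConjecture.Theorems.Ring2AbelianAllWeilSignature
import Summits.HodgeConjecture.HodgeConjecture.Theorems.Ring2AbelianAllWeilDiscriminantDescent
import Literature.AlgebraicGeometry.VanGeemen1994.HyperbolicOfSplitDiscriminant
import Literature.AlgebraicGeometry.VanGeemen1994.WeilDiscriminantOfProductTop
import Literature.AlgebraicGeometry.VanGeemen1994.WeilKFrame
import Literature.AlgebraicGeometry.Motives.SegreHyperplaneClassProdWeighted
import Literature.AlgebraicGeometry.Motives.AimedSplitProductDischarge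
import Literature.AlgebraicGeometry.HodgeTheory.HodgeRiemannDegreeOneProofs
import HarnessLib

/-!
# Ring 2 · AbelianAll (seat `ab-weil-2`, gen 3) — `A × B` with BOTH factors of ODD dimension `≥ 3`: every Weil-type pair
  `(A × B, φ × ψ)` is SPLIT; the rows `Y₃ × Y₃′` (sixfolds) from ONE sixfold fact

HONEST FRAMING (sub-cell `pub-hodge-ring2-ab-*`, verbatim): research route, not a corollary; conditional on HC_CM plus
one named minimal statement. (Cell `pub-hodge-ring2`, verbatim: research route conditional on HC_CM; not a corollary;
Q11.4-sentence-2 already refuted in dim ≥ 3.) `HC_CM` does not occur here. No definition, no named fact, no `sorry`; §2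
takes the refereed sixfold facts (Koike 2004, Schoen 1998) / the unrefereed F2 (Markman 2025) / a split cell as BINDERS.

WHAT IS PROVED. §1 `isSplitWeilType_prod_of_odd_dim` — the two-factor form of "factorwise rescaling kills the
discriminant obstruction when a factor has odd `K`-rank" (WEIL-CELLS §C / atlas-2 §16, DERIVED there; companion of
`isSplitWeilType_odd_prod_curve`, file `Ring2AbelianAllOddTimesCurve`, which is the case `dim B = 1`): `A`, `B` of
dimensions `jA + 1`, `jB + 1 ≥ 2` with `jA` EVEN (so both dimensions are odd, `2N = jA + jB + 2`), `φ ≫ φ = -d` on `A`,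
`ψ ≫ ψ = -d` on `B`, `(A × B, φ × ψ)` of Weil type `(N, N)` ⟹ SPLIT Weil type. Proof: the weighted Segre polarization
`L_A ⊠ L_B^{⊗M}` (`Motives.exists_weightedSegreEmbedding_prod`) has `K`-symmetrised class `pr_A^* h_K^A + M · pr_B^* h_K^B`;
rescaling `h_K^B ↦ M h_K^B` keeps the `K`-Gram matrices of `B` and multiplies its top coefficient by `M` (top class
`ω_B ↦ M^{jB} ω_B`), so the product witness (`VanGeemen1994.hasWeilDiscriminantNondeg_prod_of_kFrames`) has class
`[M^{jA+1} · C]`, `jA + 1` ODD; `sign C = (-1)ᴺ` (van Geemen 5.2 (4) on the carriers, ab-weil-1's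
`weilSign_eq_of_hasWeilDiscriminantNondeg`); `M = |num C|·den C` gives `[(-1)ᴺ]`; Landherr's converse
(`VanGeemen1994.IsWeilType.isSplitWeilType_of_hasWeilDiscriminantNondeg_split`, this seat gen 3). §2: the Weil classes of
`A × B` are algebraic granted the split cell `(N, d, [(-1)ᴺ])` alone; for `N = 3` (`Y₃ × Y₃′`, atlas row g6) granted
Koike 2004 (`k = ℚ(i)`) / Schoen 1998 (`k = ℚ(√-3)`) / F2 (any `k`, unrefereed) ALONE, applied directly to the split pair.

## References

* [vanGeemen1994HodgeAV] B. van Geemen, LNM 1594 (1994), Lemma 5.2 (2)–(4), 5.4 and (5.4.1).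
* [Landherr1936HermitianForms] W. Landherr, Abh. Math. Sem. Hamburg 11 (1936) 245–248.
* [Hartshorne1977] R. Hartshorne, Algebraic Geometry, II Ex. 5.11–5.12 (Segre, `𝒪(a, b)`).
* [MoonenZarhin1999LowDim] B. Moonen, Yu. Zarhin, Math. Ann. 315 (1999), Thm. 0.1 and §5 (products of Weil type).
* [Koike2004WeilHodge] K. Koike (2004), Thm. 2.1, Cor. 2.1. [Schoen1998HodgeWeilAddendum] C. Schoen, Compositio 114 (1998).
  [Markman2025SecantWeil] E. Markman, arXiv:2502.03415 (unrefereed), Thm. 1.5.1.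
-/

set_option linter.dupNamespace false

noncomputable section

open CategoryTheory

namespace Summit.HodgeConjecture.HodgeConjecture.Ring2.AbelianAll

open Literature.AlgebraicGeometry Literature.AlgebraicGeometry.Motives
open Literature.AlgebraicGeometry.HodgeTheory Literature.AlgebraicGeometry.VanGeemen1994
open Literature.AlgebraicTopology.SingularHomology
open Literature.Geometry.Kaehler
open Summit.HodgeConjecture.HodgeConjecture.WeilTypeLadder
open Summit.HodgeConjecture.HodgeConjecture.Theses
open Summit.HodgeConjecture.HodgeConjecture.Ring2.Hypotheses

/-! ## §1 Two odd-dimensional factors: always split -/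

/-- **`A × B` with `dim A`, `dim B` ODD (`≥ 3`) is of SPLIT Weil type whenever it is of Weil type `(N, N)`** (the
two-factor "factorwise rescaling", WEIL-CELLS §C / atlas-2 §16, now a theorem). Data: `dim A = jA + 1`, `dim B = jB + 1`,
`jA, jB ≥ 1`, `jA` even, `2N = jA + jB + 2`; `φ ≫ φ = -(d • 𝟙 A)`, `ψ ≫ ψ = -(d • 𝟙 B)` (`d ≥ 1`); `(A × B, φ × ψ)` of
Weil type `(N, N)`. Conclusion: `IsSplitWeilType (A × B) (φ × ψ) N d` — the `K`-symmetrised class of the weighted Segre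
polarization `L_A ⊠ L_B^{⊗M}`, `M = |num C|·den C`, is HYPERBOLIC: product discriminant `[M^{jA+1} · C]` (`jA + 1` odd;
rescaling `h_K^B` only moves the top coefficient of `B`), `sign C = (-1)ᴺ`, Landherr's converse. No named fact.
[cite: vanGeemen1994HodgeAV, Lemma 5.2 (2)–(4), 5.4 and (5.4.1)] [cite: Landherr1936HermitianForms]
[cite: Hartshorne1977, II Ex. 5.11 and Ex. 5.12] [cite: MoonenZarhin1999LowDim, Thm. 0.1 and §5] -/
theorem isSplitWeilType_prod_of_odd_dim {A B : AbelianVariety ℂ} {jA jB N : ℕ} (hA : A.dim = jA + 1)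
    (hB : B.dim = jB + 1) (hjA : 1 ≤ jA) (hjB : 1 ≤ jB) (hjA2 : Even jA) (hN : 2 * N = jA + jB + 2) {d : ℕ}
    (hd : 0 < d) {φ : A ⟶ A} {ψ : B ⟶ B} (hφ : φ ≫ φ = -(d • 𝟙 A)) (hψ : ψ ≫ ψ = -(d • 𝟙 B))
    (hW : IsWeilType (A.prod B)
      (AbelianVariety.prodLift (AbelianVariety.fst A B ≫ φ) (AbelianVariety.snd A B ≫ ψ)) N d) :
    IsSplitWeilType (A.prod B)
      (AbelianVariety.prodLift (AbelianVariety.fst A B ≫ φ) (AbelianVariety.snd A B ≫ ψ)) N d := by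
  classical
  set Φ := AbelianVariety.prodLift (AbelianVariety.fst A B ≫ φ) (AbelianVariety.snd A B ≫ ψ) with hΦ
  -- (1) the weighted Segre embeddings and the `K`-frames of the two factors
  obtain ⟨eA, aA, eB, aB, haA, haA0, haB, haB0, hemb⟩ := exists_weightedSegreEmbedding_prod A B
  obtain ⟨xA, ωA, amA, bmA, qA, tA, hxA, hiA, hωA, hωA0, hpA, hqA, htA⟩ :=
    exists_kFrame_ksymm hjA hA hd hφ eA haA haA0
  obtain ⟨xB, ωB, amB, bmB, qB, tB, hxB, hiB, hωB, hωB0, hpB, hqB, htB⟩ :=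
    exists_kFrame_ksymm hjB hB hd hψ eB haB haB0
  set hKA := (d : ℂ) • complexBetti.map eA.ι 2 aA + complexBetti.map φ.hom.hom.hom 2 (complexBetti.map eA.ι 2 aA)
    with hKAdef
  set hKB := (d : ℂ) • complexBetti.map eB.ι 2 aB + complexBetti.map ψ.hom.hom.hom 2 (complexBetti.map eB.ι 2 aB)
    with hKBdef
  -- the `K`-symmetrised class of the weighted Segre embedding is `pr_A^* h_K^A + m · pr_B^* h_K^B`
  have hKP : ∀ (m : ℕ) (e : ProjectiveEmbedding (A.prod B).X) (a : complexBetti (projectiveSpace e.n ℂ) 2),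
      complexBetti.map e.ι 2 a =
        complexBetti.map (AbelianVariety.fst A B).hom.hom.hom 2 (complexBetti.map eA.ι 2 aA) +
          ((m : ℕ) : ℂ) • complexBetti.map (AbelianVariety.snd A B).hom.hom.hom 2 (complexBetti.map eB.ι 2 aB) →
      (d : ℂ) • complexBetti.map e.ι 2 a + complexBetti.map Φ.hom.hom.hom 2 (complexBetti.map e.ι 2 a) =
        complexBetti.map (AbelianVariety.fst A B).hom.hom.hom 2 hKA +
          complexBetti.map (AbelianVariety.snd A B).hom.hom.hom 2 ((((m : ℚ)) : ℂ) • hKB) := by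
    intro m e a he
    rw [he, map_add, map_smul, map_prodLift_map_fst φ ψ 2, map_prodLift_map_snd φ ψ 2, hKAdef, hKBdef]
    simp only [map_add, map_smul, smul_add, smul_smul]
    push_cast
    module
  -- (2) the `K`-frame data of `B` for the rescaled class `m · h_K^B`: same Gram matrices, top class `m^{jB} ω_B`,
  -- top coefficient `m · t_B`
  have hpB' : ∀ (m : ℕ) (i j : Fin (jB + 1)),
      polarizationPairingOne B.X ((((m : ℚ)) : ℂ) • hKB) jB (xB i) (complexBetti.map ψ.hom.hom.hom 1 (xB j)) =
          ((amB i j : ℚ) : ℂ) • (((((m : ℚ) ^ jB : ℚ)) : ℂ) • ωB) ∧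
        polarizationPairingOne B.X ((((m : ℚ)) : ℂ) • hKB) jB (xB i) (xB j) =
          ((bmB i j : ℚ) : ℂ) • (((((m : ℚ) ^ jB : ℚ)) : ℂ) • ωB) := by
    intro m i j
    obtain ⟨h1, h2⟩ := hpB i j
    refine ⟨?_, ?_⟩
    · rw [polarizationPairingOne_smul, h1, smul_smul, smul_smul, Rat.cast_pow]
      congr 1
      exact mul_comm _ _
    · rw [polarizationPairingOne_smul, h2, smul_smul, smul_smul, Rat.cast_pow]
      congr 1
      exact mul_comm _ _
  have htB' : ∀ m : ℕ, lefschetzPow ((((m : ℚ)) : ℂ) • hKB) jB 2 ((((m : ℚ)) : ℂ) • hKB) =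
      ((((m : ℚ) * tB : ℚ)) : ℂ) • (((((m : ℚ) ^ jB : ℚ)) : ℂ) • ωB) := by
    intro m
    rw [HodgeRiemannDegreeOne.lefschetzPow_smul_self, htB, smul_smul, smul_smul]
    congr 1
    push_cast
    ring
  -- (3) the product witness of weight `m`: class `[m^{jA+1} · C]`
  let ε : Fin (jA + 1) ⊕ Fin (jB + 1) ≃ Fin (2 * N) := finSumFinEquiv.trans (finCongr (by omega))
  set C : ℚ := (((2 * N - 1).choose jA : ℚ) * tB) ^ (jA + 1) * ((((2 * N - 1).choose (jA + 1) : ℚ)) * tA) ^ (jB + 1) *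
    qA * qB with hC
  have witness : ∀ m : ℕ, 0 < m → ∃ (e : ProjectiveEmbedding (A.prod B).X) (a : complexBetti (projectiveSpace e.n ℂ) 2)
      (w : ℚˣ), IsRationalClass a ∧ a ≠ 0 ∧ (w : ℚ) = (m : ℚ) ^ (jA + 1) * C ∧
        HasWeilDiscriminantNondeg (A.prod B) Φ N d
          ((d : ℂ) • complexBetti.map e.ι 2 a + complexBetti.map Φ.hom.hom.hom 2 (complexBetti.map e.ι 2 a))
          (QuotientGroup.mk w) := by
    intro m hm
    obtain ⟨e, a, ha, ha0, he⟩ := hemb m hm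
    have hh := hKP m e a he
    have hm0 : ((m : ℚ) ^ jB) ≠ 0 := pow_ne_zero _ (by exact_mod_cast hm.ne')
    have hωr : IsRationalClass ((((((m : ℚ) ^ jB : ℚ)) : ℂ) • ωB)) := hωB.smul _
    have hω0 : (((((m : ℚ) ^ jB : ℚ)) : ℂ) • ωB) ≠ 0 := smul_ne_zero (by exact_mod_cast hm0) hωB0
    obtain ⟨htA0, htB0⟩ := prod_kFrames_top_ne_zero hA hB hN (kA := jA + 1) (kB := jB + 1) (by omega) (by omega)
      (by omega) hd hφ hψ xA hxA hiA hKA ωA amA bmA hpA tA htA xB hxB hiB ((((m : ℚ)) : ℂ) • hKB)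
      (((((m : ℚ) ^ jB : ℚ)) : ℂ) • ωB) amB bmB (hpB' m) ((m : ℚ) * tB) (htB' m) e ha ha0 hh
    have hδ := hasWeilDiscriminantNondeg_prod_of_kFrames hA hB hN ε xA hxA hiA hKA ωA hωA hωA0 amA bmA hpA tA htA
      htA0 qA hqA xB hxB hiB ((((m : ℚ)) : ℂ) • hKB) (((((m : ℚ) ^ jB : ℚ)) : ℂ) • ωB) hωr hω0 amB bmB (hpB' m)
      ((m : ℚ) * tB) (htB' m) htB0 qB hqB
    rw [← hh] at hδ
    refine ⟨e, a, _, ha, ha0, ?_, hδ⟩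
    rw [Units.val_mul, Units.val_mul, Units.val_mk0, hC]
    ring
  -- (4) the sign at weight 1: `sign C = (-1)ᴺ` (van Geemen 5.2 (4) on the carriers)
  obtain ⟨e₁, a₁, w₁, ha₁, ha₁0, hw₁, hδ₁⟩ := witness 1 one_pos
  have hsign := weilSign_eq_of_hasWeilDiscriminantNondeg hW e₁ ha₁ ha₁0 hδ₁
  rw [weilSign_mk_eq_neg_one_pow_iff, hw₁, Nat.cast_one, one_pow, one_mul] at hsign
  have hC0 : C ≠ 0 := by
    intro h0
    rw [h0, mul_zero] at hsign
    exact lt_irrefl _ hsign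
  -- (5) the weight `M = |num C| · den C`: `M · C = |num C| · num C`, and `jA + 1 = 2L + 1` is odd
  obtain ⟨L, hL⟩ := hjA2
  set M : ℕ := C.num.natAbs * C.den with hMdef
  have hnum0 : C.num ≠ 0 := Rat.num_ne_zero.2 hC0
  have hMpos : 0 < M := Nat.mul_pos (Int.natAbs_pos.2 hnum0) C.den_pos
  have hMC : (M : ℚ) * C = (C.num.natAbs : ℚ) * C.num := by
    rw [hMdef, Nat.cast_mul, mul_assoc, Rat.den_mul_eq_num]
  obtain ⟨e, a, w, ha, ha0, hw, hδ⟩ := witness M hMpos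
  have hwval : (w : ℚ) = ((M : ℚ) ^ L) ^ 2 * ((C.num.natAbs : ℚ) * C.num) := by
    rw [hw, hL, show L + L + 1 = 2 * L + 1 by ring, pow_succ, pow_mul', mul_assoc, hMC]
  have hMnz : (M : ℚ) ^ L ≠ 0 := pow_ne_zero _ (by exact_mod_cast hMpos.ne')
  have hnzQ : (C.num : ℚ) ≠ 0 := by exact_mod_cast hnum0
  have hv0 : (M : ℚ) ^ L * C.num ≠ 0 := mul_ne_zero hMnz hnzQ
  have hsq : Units.mk0 ((M : ℚ) ^ L * C.num) hv0 ^ 2 ∈ normUnitsSubgroup ℚ (weilField d) := by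
    have h := pow_finrank_mem_normUnitsSubgroup (F := ℚ) (K := weilField d) (Units.mk0 ((M : ℚ) ^ L * C.num) hv0)
    rwa [finrank_weilField] at h
  have hclass : (QuotientGroup.mk w : weilNormResidueGroup d) = QuotientGroup.mk ((-1 : ℚˣ) ^ N) := by
    rcases neg_one_pow_eq_or ℚ N with hpos | hneg
    · -- `(-1)ᴺ = 1`: `C > 0`, `|num C| · num C = (num C)²`, `w` is a square
      rw [hpos, one_mul] at hsign
      have hn : 0 < C.num := Rat.num_pos.2 hsign
      have habs : ((C.num.natAbs : ℕ) : ℚ) = (C.num : ℚ) := by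
        rw [← Int.cast_natCast, Int.natAbs_of_nonneg hn.le]
      have hwsq : w = Units.mk0 ((M : ℚ) ^ L * C.num) hv0 ^ 2 :=
        Units.ext (by rw [hwval, habs, Units.val_pow_eq_pow_val, Units.val_mk0]; ring)
      have hunit : ((-1 : ℚˣ) ^ N) = 1 :=
        Units.ext (by rw [Units.val_pow_eq_pow_val, Units.val_neg, Units.val_one, hpos])
      rw [hunit, QuotientGroup.mk_one, hwsq]
      exact (QuotientGroup.eq_one_iff _).2 hsq
    · -- `(-1)ᴺ = -1`: `C < 0`, `|num C| · num C = -(num C)²`, `w = (-1)ᴺ · square`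
      rw [hneg, neg_one_mul, neg_pos] at hsign
      have hn : C.num < 0 := Rat.num_neg.2 hsign
      have habs : ((C.num.natAbs : ℕ) : ℚ) = -(C.num : ℚ) := by
        rw [← Int.cast_natCast, Int.ofNat_natAbs_of_nonpos hn.le, Int.cast_neg]
      have hwsq : w = (-1 : ℚˣ) ^ N * Units.mk0 ((M : ℚ) ^ L * C.num) hv0 ^ 2 :=
        Units.ext (by
          rw [hwval, habs, Units.val_mul, Units.val_pow_eq_pow_val, Units.val_pow_eq_pow_val, Units.val_neg,
            Units.val_one, hneg, Units.val_mk0]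
          ring)
      rw [hwsq, QuotientGroup.mk_mul, (QuotientGroup.eq_one_iff _).2 hsq, mul_one]
  rw [hclass] at hδ
  -- (6) Landherr's converse on the carriers
  exact VanGeemen1994.IsWeilType.isSplitWeilType_of_hasWeilDiscriminantNondeg_split hW e ha ha0 hδ

/-! ## §2 Consequences: the Weil classes of `A × B` from ONE split-cell statement; `Y₃ × Y₃′` from ONE sixfold fact -/

/-- **The Weil classes of `A × B` (both factors odd-dimensional, `≥ 3`) are algebraic granted the split cell
`(N, d, [(-1)ᴺ])` ALONE** (binder `h : WeilClassesComponent N d (splitDiscriminantClass N d)`): §1 +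
`Ring2.Hypotheses.weilClasses_algebraic_of_isSplitWeilType_of_split_component`.
[cite: vanGeemen1994HodgeAV, Lemma 5.2 and (5.4.1)] [cite: MoonenZarhin1999LowDim, §5] -/
theorem weilClasses_algebraic_prod_of_odd_dim_of_split_component {A B : AbelianVariety ℂ} {jA jB N : ℕ}
    (hA : A.dim = jA + 1) (hB : B.dim = jB + 1) (hjA : 1 ≤ jA) (hjB : 1 ≤ jB) (hjA2 : Even jA)
    (hN : 2 * N = jA + jB + 2) {d : ℕ} (hd : 0 < d) (h : WeilClassesComponent N d (splitDiscriminantClass N d))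
    {φ : A ⟶ A} {ψ : B ⟶ B} (hφ : φ ≫ φ = -(d • 𝟙 A)) (hψ : ψ ≫ ψ = -(d • 𝟙 B))
    (hW : IsWeilType (A.prod B)
      (AbelianVariety.prodLift (AbelianVariety.fst A B ≫ φ) (AbelianVariety.snd A B ≫ ψ)) N d)
    {c : complexBetti (A.prod B).X (2 * N)} (hcQ : IsRationalClass c)
    (hcH : IsOfHodgeType (2 * N) (A.prod B).X (2 * N) N N c)
    (hw : c ∈ weilClassesOf (A.prod B)
      (AbelianVariety.prodLift (AbelianVariety.fst A B ≫ φ) (AbelianVariety.snd A B ≫ ψ)) N d) :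
    c ∈ algebraicClasses (A.prod B).X N :=
  weilClasses_algebraic_of_isSplitWeilType_of_split_component h
    (isSplitWeilType_prod_of_odd_dim hA hB hjA hjB hjA2 hN hd hφ hψ hW) hcQ hcH hw

/-- **The Weil classes of `Y₃ × Y₃′` (two threefolds, `k = ℚ(i)`) are algebraic granted Koike 2004 ALONE** (atlas row
g6 `Y₃ × Y₃′`; refereed named fact `hK` in hyperbolic-sixfold form, applied DIRECTLY to the split pair of §1).
[cite: Koike2004WeilHodge, Thm. 2.1 and Cor. 2.1] [cite: vanGeemen1994HodgeAV, (5.4.1)] -/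
theorem weilClasses_algebraic_threefold_prod_threefold_of_koike
    (hK : Koike2004_weilClasses_algebraic_hyperbolicSixfold_one)
    {A B : AbelianVariety ℂ} (hA : A.dim = 3) (hB : B.dim = 3) {φ : A ⟶ A} {ψ : B ⟶ B}
    (hφ : φ ≫ φ = -((1 : ℕ) • 𝟙 A)) (hψ : ψ ≫ ψ = -((1 : ℕ) • 𝟙 B))
    (hW : IsWeilType (A.prod B)
      (AbelianVariety.prodLift (AbelianVariety.fst A B ≫ φ) (AbelianVariety.snd A B ≫ ψ)) 3 1)
    {c : complexBetti (A.prod B).X (2 * 3)} (hcQ : IsRationalClass c)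
    (hcH : IsOfHodgeType (2 * 3) (A.prod B).X (2 * 3) 3 3 c)
    (hw : c ∈ weilClassesOf (A.prod B)
      (AbelianVariety.prodLift (AbelianVariety.fst A B ≫ φ) (AbelianVariety.snd A B ≫ ψ)) 3 1) :
    c ∈ algebraicClasses (A.prod B).X 3 := by
  obtain ⟨-, -, hP, hΦ2, e, a, ha, ha0, hh⟩ :=
    isSplitWeilType_iff.1 (isSplitWeilType_prod_of_odd_dim (jA := 2) (jB := 2) (N := 3) hA hB (by norm_num)
      (by norm_num) ⟨1, rfl⟩ rfl one_pos hφ hψ hW)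
  exact hK (A.prod B) _ hP (isSmoothProjective_of_dim_eq' hP) hΦ2 e a ha ha0 hh c hcQ hcH hw

/-- **The Weil classes of `Y₃ × Y₃′`, `k = ℚ(√-3)`, are algebraic granted Schoen 1998 ALONE** (refereed named fact
`hS`, applied directly to the split pair of §1). [cite: Schoen1998HodgeWeilAddendum] [cite: vanGeemen1994HodgeAV, 7.3 and (5.4.1)] -/
theorem weilClasses_algebraic_threefold_prod_threefold_of_schoen
    (hS : Schoen1998_weilClasses_algebraic_hyperbolicSixfold_three)
    {A B : AbelianVariety ℂ} (hA : A.dim = 3) (hB : B.dim = 3) {φ : A ⟶ A} {ψ : B ⟶ B}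
    (hφ : φ ≫ φ = -((3 : ℕ) • 𝟙 A)) (hψ : ψ ≫ ψ = -((3 : ℕ) • 𝟙 B))
    (hW : IsWeilType (A.prod B)
      (AbelianVariety.prodLift (AbelianVariety.fst A B ≫ φ) (AbelianVariety.snd A B ≫ ψ)) 3 3)
    {c : complexBetti (A.prod B).X (2 * 3)} (hcQ : IsRationalClass c)
    (hcH : IsOfHodgeType (2 * 3) (A.prod B).X (2 * 3) 3 3 c)
    (hw : c ∈ weilClassesOf (A.prod B)
      (AbelianVariety.prodLift (AbelianVariety.fst A B ≫ φ) (AbelianVariety.snd A B ≫ ψ)) 3 3) :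
    c ∈ algebraicClasses (A.prod B).X 3 := by
  obtain ⟨-, -, hP, hΦ2, e, a, ha, ha0, hh⟩ :=
    isSplitWeilType_iff.1 (isSplitWeilType_prod_of_odd_dim (jA := 2) (jB := 2) (N := 3) hA hB (by norm_num)
      (by norm_num) ⟨1, rfl⟩ rfl (by norm_num) hφ hψ hW)
  exact hS (A.prod B) _ hP (isSmoothProjective_of_dim_eq' hP) hΦ2 e a ha ha0 hh c hcQ hcH hw

/-- **The Weil classes of `Y₃ × Y₃′`, any `k = ℚ(√-d)`, are algebraic granted Markman's hyperbolic-sixfold statement F2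
ALONE** (UNREFEREED named fact `hM`, applied directly to the split pair of §1).
[cite: Markman2025SecantWeil, Thm. 1.5.1 (preprint, unrefereed)] [cite: vanGeemen1994HodgeAV, (5.4.1)] -/
theorem weilClasses_algebraic_threefold_prod_threefold_of_markmanSixfolds
    (hM : Markman2025_weilClasses_algebraic_hyperbolicSixfold)
    {A B : AbelianVariety ℂ} (hA : A.dim = 3) (hB : B.dim = 3) {d : ℕ} (hd : 0 < d) {φ : A ⟶ A} {ψ : B ⟶ B}
    (hφ : φ ≫ φ = -(d • 𝟙 A)) (hψ : ψ ≫ ψ = -(d • 𝟙 B))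
    (hW : IsWeilType (A.prod B)
      (AbelianVariety.prodLift (AbelianVariety.fst A B ≫ φ) (AbelianVariety.snd A B ≫ ψ)) 3 d)
    {c : complexBetti (A.prod B).X (2 * 3)} (hcQ : IsRationalClass c)
    (hcH : IsOfHodgeType (2 * 3) (A.prod B).X (2 * 3) 3 3 c)
    (hw : c ∈ weilClassesOf (A.prod B)
      (AbelianVariety.prodLift (AbelianVariety.fst A B ≫ φ) (AbelianVariety.snd A B ≫ ψ)) 3 d) :
    c ∈ algebraicClasses (A.prod B).X 3 := by
  obtain ⟨-, -, hP, hΦ2, e, a, ha, ha0, hh⟩ :=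
    isSplitWeilType_iff.1 (isSplitWeilType_prod_of_odd_dim (jA := 2) (jB := 2) (N := 3) hA hB (by norm_num)
      (by norm_num) ⟨1, rfl⟩ rfl hd hφ hψ hW)
  exact hM d hd (A.prod B) _ hP (isSmoothProjective_of_dim_eq' hP) hΦ2 e a ha ha0 hh c hcQ hcH hw

end Summit.HodgeConjecture.HodgeConjecture.Ring2.AbelianAll

end
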